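import Mathlib
import HarnessLib.Audit
import Summits.PneNP.PneNP.Theorems.PstarGateUnitCycleChamber
import Summits.PneNP.PneNP.Theorems.PstarGateUnitCycleRankSix
import Summits.PneNP.PneNP.Theorems.PstarGateChamberAlgebra
import Summits.PneNP.PneNP.Theorems.PstarGateForest
import Summits.PneNP.PneNP.Theorems.PstarNorUnitEQ1Tools

/-!
# One GATED chord, node N6 CLOSED: the single gated cycle has at most five outputs — `gateUnitCycleQuadX_holds` (E2; prover-1 g19)

FRONTIER range-avoidance ladder, rung F-N3 (`stmt-PneNP-19007`), cell `pnp-ideate` (`PstarGateNodesX.GateUnitCycleQuadX`; this seat's NOTES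
`## N6X architecture`); restricted-model proof complexity — nothing here bears on `P` versus `NP`.

`N = {e}`, `J₀ = D e + e`, gate `g₀ = (p, u)` with coefficient `ℓ = κ₀ + x_u`, chambers `H₁ = {ℓ = 1}`, `H₀ = {ℓ = 0}` over `W = coordKer {u}`.
`PstarGateUnitCycleChamber.single_chamber_cases`: `#J₀ = 3`, or `Q_{D e}` has rank `≥ 4` on `W` and (EQ) ∨ (EXC) ∨ (NOR) on `H₁`.  In the second case
the SHARING BUDGET (`PstarGateUnitCycleBudget`) gives `#J₀ ≤ 5` unless three edges of `D e` avoid `u`, and then `Q_{D e}` has rank `≥ 6` on `W`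
(`PstarGateUnitCycleRankSix.rank_six_on_chamber`); at rank six (`PstarGateChamberAlgebra`) (NOR) is impossible, (EXC) is (EQ), and

* `eq_false_of_rank_six` — **(EQ) is empty**: the INSTANCE form of `PstarGateChamberAlgebra.eq_chambers_false`.  The two chambers carry `q = q_{(1,0)}`
  and `q' = q_{(0,1)} = F₁ + t₁` (restrictions of the same quadratics to parallel flats, so they differ by affine functions); (T3) reads
  `Z(q) ∩ H₁ ⊆ {u_e = 1} ∩ Z(q')` (`caseP_forced`, `caseP_fst` with `ℓ = 1`) and `Z(q) ∩ H₀ ⊆ {q' = 1}` (`caseP_fst` with `ℓ = 0`); (M0) at `e`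
  gives a point of `Z(q) ∩ H₁` (`zpoint_of_single`); (M0) at an edge `j` of `D e` avoiding `u` (`avoid_nonempty`), in defect form
  (`PstarGateForest.gate_forest_minimality`, `defect_eq_one`), gives a base point `x` with `q(x) = [j ∈ T₂] = 1` (`j ∈ T₂` because the polar
  forms of `q` and `Q_{D e}` agree on `W`, `polarDir_single_pair`), `q'(x) = [j ∈ T₁] + x_p·ℓ(x)`, and `x_p = 1` when `u_e(x) = 0` — in `H₀`
  or in `H₁`, the (M0) datum of the model lemma; `[j ∈ T₁]` is the value of the polar form of `q'` on the AND pair of `j`.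
* `gateUnitCycleQuadX_holds : GateUnitCycleQuadX` — **node N6 (v2) HOLDS** (the hypothesis "`q` not affine" is not even used: the argument
  re-proves N6′).  E2 open surface after this file: N2X, N3X, N4X, N5X.
-/

set_option linter.dupNamespace false -- `Summit.PneNP.PneNP.…`: summit = sub-problem name (D-0017 single-conjunct layout)

open Finset Module Literature.Computability.Complexity
open Summit.PneNP.PneNP.Theorems.PstarFibrePolys (bit)
open Summit.PneNP.PneNP.Theorems.PstarTyped (Typed)
open Summit.PneNP.PneNP.Theorems.PstarSALevel (BoundaryExpanding SimpleOverlap)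
open Summit.PneNP.PneNP.Theorems.PstarCoreBound (XorClosed)
open Summit.PneNP.PneNP.Theorems.PstarCubeIdeals (IsAffineFn isAffineFn_of_linear)
open Summit.PneNP.PneNP.Theorems.PstarProductRank (qform polar)
open Summit.PneNP.PneNP.Theorems.PstarQuadRank (rad)
open Summit.PneNP.PneNP.Theorems.PstarForcing (polar_unique)
open Summit.PneNP.PneNP.Theorems.PstarQuadRestrict (quad_restrict)
open Summit.PneNP.PneNP.Theorems.PstarPathRank (AndAdj polar_basis)
open Summit.PneNP.PneNP.Theorems.PstarPathRankFibre (coordKer mem_coordKer avoid)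
open Summit.PneNP.PneNP.Theorems.PstarReadSumset (V2)
open Summit.PneNP.PneNP.Theorems.PstarChordSystem (ChordSystem)
open Summit.PneNP.PneNP.Theorems.PstarChordBridgeTools (privs coef xpdeg vars_mem_privs)
open Summit.PneNP.PneNP.Theorems.PstarChordBridge (BridgeData sys sys_F sys_t Solution Lift)
open Summit.PneNP.PneNP.Theorems.PstarChordBridgeCotree (Peelable)
open Summit.PneNP.PneNP.Theorems.PstarChordBridgeForcing (gam sys_u_eq qform_add')
open Summit.PneNP.PneNP.Theorems.PstarChordBridgeBasis (qDir polarDir)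
open Summit.PneNP.PneNP.Theorems.PstarChordBridgeCorner (qDir_add val_singleton andAdj_iff_mem)
open Summit.PneNP.PneNP.Theorems.PstarChordBridgeForest (defect_eq_one)
open Summit.PneNP.PneNP.Theorems.PstarNorUnitEQ1Tools (polarDir_single_pair)
open Summit.PneNP.PneNP.Theorems.PstarGateBridge (GateHyp gate_reads caseP_forced caseP_fst)
open Summit.PneNP.PneNP.Theorems.PstarGateForest (gate_forest_minimality)
open Summit.PneNP.PneNP.Theorems.PstarGateFibreRank (avoid_nonempty)
open Summit.PneNP.PneNP.Theorems.PstarGateNodes (GateData)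
open Summit.PneNP.PneNP.Theorems.PstarGateNodesX (GateDataX GateUnitCycleQuadX)
open Summit.PneNP.PneNP.Theorems.PstarGateUnitCycleAffine (qDir_one_zero zpoint_of_single)
open Summit.PneNP.PneNP.Theorems.PstarGateUnitCycleChamber (single_chamber_cases)
open Summit.PneNP.PneNP.Theorems.PstarGateUnitCycleBudget (card_le_five_of_avoid_le_two)
open Summit.PneNP.PneNP.Theorems.PstarGateUnitCycleRankSix (rank_six_on_chamber)
open Summit.PneNP.PneNP.Theorems.PstarGateChamberAlgebra (nor_not_rank_six exc_product_const eq_chambers_false)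

namespace Summit.PneNP.PneNP.Theorems.PstarGateUnitCycleQuad

variable {n m : ℕ}

/-- Every element of `𝔽₂` is `0` or `1`. -/
private theorem zmod2_cases (t : ZMod 2) : t = 0 ∨ t = 1 := by
  revert t; decide

/-- `q_{(0,1)}` is the first coordinate of the state-free part plus the first target: `F₁ + t₁`. -/
theorem qDir_zero_one (I : LocalMap 4 n m) (B : BridgeData n m) (x : Fin n → ZMod 2) :
    qDir I B (0, 1) x = ((sys I B).F x).1 + (sys I B).t.1 := by
  unfold PstarChordBridgeBasis.qDir
  rw [sys_F, sys_t]
  simp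

/-- Restrictions of one quadratic to two parallel flats differ by an affine function. -/
theorem isAffineFn_two_shifts {V : Type*} [AddCommGroup V] [Module (ZMod 2) V] {q : V → ZMod 2} {Bf : LinearMap.BilinForm (ZMod 2) V}
    (hq : ∀ x w, q (x + w) = q x + q w + q 0 + Bf x w) (W : Submodule (ZMod 2) V) (x₀ x₁ : V) :
    IsAffineFn (fun w : W => q (x₁ + w) + q (x₀ + w)) := by
  intro v w
  simp only [Submodule.coe_add, Submodule.coe_zero, add_zero]
  rw [hq x₁ (↑v + ↑w), hq x₀ (↑v + ↑w), hq (↑v : V) ↑w, hq x₁ ↑v, hq x₀ ↑v, hq x₁ ↑w, hq x₀ ↑w, map_add, map_add]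
  generalize q x₁ = a; generalize q x₀ = b; generalize q (↑v : V) = c; generalize q (↑w : V) = d; generalize q 0 = z
  generalize Bf (↑v : V) (↑w : V) = s; generalize Bf x₁ (↑v : V) = s₁; generalize Bf x₁ (↑w : V) = s₂
  generalize Bf x₀ (↑v : V) = s₃; generalize Bf x₀ (↑w : V) = s₄
  revert a b c d z s s₁ s₂ s₃ s₄; decide

/-- **The (EQ) chamber regime of the single gated cycle is empty at rank six** (instance form of `eq_chambers_false`). -/
theorem eq_false_of_rank_six (I : LocalMap 4 n m) (hI : I.IsPure xorAndPred) (hT : Typed I) (hS : SimpleOverlap I) {r : ℕ}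
    {B : BridgeData n m} {e g₀ : Fin m} {u : Fin n} {κ₀ : ZMod 2} (hD : GateDataX I r B e g₀ u κ₀)
    (hN : B.N = {e})
    (h6 : finrank (ZMod 2) (rad ((polar (B.D e) (fun j => I.vars j 2) (fun j => I.vars j 3)).restrict (coordKer ({u} : Finset (Fin n))))) + 6 ≤
      finrank (ZMod 2) (coordKer ({u} : Finset (Fin n))))
    (hEQ : ∃ κ : ZMod 2, ∀ w : coordKer ({u} : Finset (Fin n)),
      qform (B.D e) (fun j => I.vars j 2) (fun j => I.vars j 3) ((Pi.single u (κ₀ + 1) : Fin n → ZMod 2) + (w : Fin n → ZMod 2)) =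
        qDir I B (1, 0) ((Pi.single u (κ₀ + 1) : Fin n → ZMod 2) + (w : Fin n → ZMod 2)) + κ) : False := by
  classical
  obtain ⟨hXc, hW, hr, hd₁, hd₂, hL, hPe, -, hG, hg₀, hgv, hju, hup, hux, hG₁p, hcoef, hT3, hM0⟩ := id hD
  obtain ⟨κ, hκ⟩ := hEQ
  set W : Submodule (ZMod 2) (Fin n → ZMod 2) := coordKer ({u} : Finset (Fin n)) with hWdef
  set x₀ : Fin n → ZMod 2 := Pi.single u (κ₀ + 1) with hx₀
  set x₁ : Fin n → ZMod 2 := Pi.single u κ₀ with hx₁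
  set D := B.D e with hDdef
  have he : e ∈ B.N := by rw [hN]; exact mem_singleton_self _
  have heD : e ∉ D := fun h => (mem_sdiff.1 (hW.hD e he h)).2 he
  have hDJ : D ⊆ B.J₀ := (hW.hD e he).trans sdiff_subset
  have hothers : ∀ e' ∈ B.N, e' ≠ e → False := fun e' he' hne => hne (by rw [hN] at he'; exact mem_singleton.1 he')
  have hP : ∀ e' ∈ B.N, e' ≠ e → ∀ a, ((sys I B).ρ e' a = 0 ∨ (sys I B).ρ e' a = (1, 0)) ∧ ((sys I B).ρ' e' a = 0 ∨ (sys I B).ρ' e' a = (1, 0)) :=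
    fun e' he' hne => (hothers e' he' hne).elim
  have hread : ∀ e' ∈ B.N, e' ≠ e → ∀ a, (sys I B).ρ e' a ≠ 0 ∨ (sys I B).ρ' e' a ≠ 0 := fun e' he' hne => (hothers e' he' hne).elim
  -- coordinates on the chambers
  have hx₀u : x₀ u = κ₀ + 1 := by rw [hx₀, Pi.single_eq_same]
  have hx₁u : x₁ u = κ₀ := by rw [hx₁, Pi.single_eq_same]
  have hwu : ∀ w : W, (w : Fin n → ZMod 2) u = 0 := fun w => (mem_coordKer.1 w.2) u (mem_singleton_self u)
  have hc1 : ∀ w : W, coef I B.C₁ B.G₁ (I.vars e 2) (x₀ + (w : Fin n → ZMod 2)) = 1 := by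
    intro w
    rw [hcoef, Pi.add_apply, hx₀u, hwu w, add_zero]
    have e2 : ∀ k : ZMod 2, k + (k + 1) = 1 := by decide
    exact e2 κ₀
  have hc0 : ∀ w : W, coef I B.C₁ B.G₁ (I.vars e 2) (x₁ + (w : Fin n → ZMod 2)) = 0 := by
    intro w
    rw [hcoef, Pi.add_apply, hx₁u, hwu w, add_zero]
    exact CharTwo.add_self_eq_zero κ₀
  -- the chamber functions
  set q₁ : W → ZMod 2 := fun w => qDir I B (1, 0) (x₀ + (w : Fin n → ZMod 2)) with hq₁def
  set q₀ : W → ZMod 2 := fun w => qDir I B (1, 0) (x₁ + (w : Fin n → ZMod 2)) with hq₀def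
  set q'₁ : W → ZMod 2 := fun w => qDir I B (0, 1) (x₀ + (w : Fin n → ZMod 2)) with hq'₁def
  set q'₀ : W → ZMod 2 := fun w => qDir I B (0, 1) (x₁ + (w : Fin n → ZMod 2)) with hq'₀def
  set Q₁ : W → ZMod 2 := fun w => (sys I B).u e (x₀ + (w : Fin n → ZMod 2)) with hQ₁def
  set Bq := (polarDir I B (1, 0)).restrict W with hBqdef
  set Bq' := (polarDir I B (0, 1)).restrict W with hBq'def
  set Bα := (polar D (fun j => I.vars j 2) (fun j => I.vars j 3)).restrict W with hBαdef
  have hq₁ : ∀ v w : W, q₁ (v + w) = q₁ v + q₁ w + q₁ 0 + Bq v w := fun v w => quad_restrict (qDir_add I B (1, 0)) W x₀ v w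
  have hq'₁ : ∀ v w : W, q'₁ (v + w) = q'₁ v + q'₁ w + q'₁ 0 + Bq' v w := fun v w => quad_restrict (qDir_add I B (0, 1)) W x₀ v w
  have hPq : ∀ v w : W, qform D (fun j => I.vars j 2) (fun j => I.vars j 3) (x₀ + ((v + w : W) : Fin n → ZMod 2)) =
      qform D (fun j => I.vars j 2) (fun j => I.vars j 3) (x₀ + (v : Fin n → ZMod 2)) +
      qform D (fun j => I.vars j 2) (fun j => I.vars j 3) (x₀ + (w : Fin n → ZMod 2)) +
      qform D (fun j => I.vars j 2) (fun j => I.vars j 3) (x₀ + ((0 : W) : Fin n → ZMod 2)) + Bα v w := quad_restrict (qform_add' I D) W x₀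
  -- (EQ): `q₁` has the polar form of `Q_{D e}` on the chamber, hence rank six
  have hq₁' : ∀ v w : W, q₁ (v + w) = q₁ v + q₁ w + q₁ 0 + Bα v w := by
    intro v w
    have h := hPq v w
    rw [hκ (v + w), hκ v, hκ w, hκ 0] at h
    have e4 : ∀ a b c d s k : ZMod 2, a + k = b + k + (c + k) + (d + k) + s → a = b + c + d + s := by decide
    exact e4 _ _ _ _ _ _ h
  have hBeq : Bq = Bα := polar_unique hq₁ hq₁'
  have hrank : finrank (ZMod 2) (rad Bq) + 6 ≤ finrank (ZMod 2) W := by rw [hBeq]; exact h6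
  -- the two chambers differ by affine functions
  have h₀ : IsAffineFn (fun w : W => q₀ w + q₁ w) := isAffineFn_two_shifts (qDir_add I B (1, 0)) W x₀ x₁
  have h₀' : IsAffineFn (fun w : W => q'₀ w + q'₁ w) := isAffineFn_two_shifts (qDir_add I B (0, 1)) W x₀ x₁
  -- (EQ) for `u_e`
  have hEQ' : ∀ w, Q₁ w = q₁ w + (gam B e + κ) := by
    intro w
    show (sys I B).u e (x₀ + (w : Fin n → ZMod 2)) = qDir I B (1, 0) (x₀ + (w : Fin n → ZMod 2)) + (gam B e + κ)
    rw [sys_u_eq, hκ w]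
    ring
  -- (T3) on `H₁`: `Z(q) ⊆ {u_e = 1}`
  have hZ : ∀ w, q₁ w = 0 → Q₁ w = 1 := by
    intro w hw
    have h := (caseP_forced I hI hT hW hL hG hT3 hP hread hw).2 (by rw [hc1]; exact one_ne_zero)
    show (sys I B).u e (x₀ + (w : Fin n → ZMod 2)) = 1
    rw [sys_u_eq, h]
    have e2 : ∀ g : ZMod 2, g + (g + 1) = 1 := by decide
    exact e2 _
  -- (M0) at `e`: a point of `Z(q) ∩ H₁`
  have hpt : ∃ w, q₁ w = 0 := by
    obtain ⟨a, hqa, hca⟩ := zpoint_of_single I hI hT hW hL hG hN hT3 (hM0 e (hW.hN he))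
    have hau : a u = κ₀ + 1 := by
      rw [hcoef] at hca
      have e2 : ∀ k v : ZMod 2, k + v ≠ 0 → v = k + 1 := by decide
      exact e2 _ _ hca
    have haW : a + x₀ ∈ W := by
      rw [mem_coordKer]
      intro w hw
      rw [mem_singleton] at hw
      subst hw
      rw [Pi.add_apply, hau, hx₀u, CharTwo.add_self_eq_zero]
    refine ⟨⟨a + x₀, haW⟩, ?_⟩
    have hx : x₀ + (a + x₀) = a := by
      ext v
      rw [Pi.add_apply, Pi.add_apply, add_comm (a v), ← add_assoc, CharTwo.add_self_eq_zero, zero_add]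
    show qDir I B (1, 0) (x₀ + (a + x₀)) = 0
    rw [hx]
    exact hqa
  -- (T3) on `H₁`: `Z(q) ⊆ Z(q')` (the gate reads with `ℓ = 1` and the chord is ON)
  have hI' : ∀ w, q₁ w = 0 → q'₁ w = 0 := by
    intro w hw
    have hfst := caseP_fst I hI hT hW hL hG hT3 hP hw
    have hue : ¬ (sys I B).u e (x₀ + (w : Fin n → ZMod 2)) = 0 := by
      have h := hZ w hw
      simp only [hQ₁def] at h
      rw [h]; exact one_ne_zero
    have hsum : ∑ i ∈ B.N.filter (fun i => ¬ (sys I B).u i (x₀ + (w : Fin n → ZMod 2)) = 0),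
        ((sys I B).ρ i (x₀ + (w : Fin n → ZMod 2)) + (sys I B).ρ' i (x₀ + (w : Fin n → ZMod 2))).1 = 1 := by
      rw [hN, filter_singleton, if_pos hue, sum_singleton, (gate_reads I hI hG _).1, (gate_reads I hI hG _).2, add_zero, hc1]
    rw [hsum] at hfst
    show qDir I B (0, 1) (x₀ + (w : Fin n → ZMod 2)) = 0
    rw [qDir_zero_one]
    have e2 : ∀ a b : ZMod 2, a + 1 = b + 1 → a + b = 0 := by decide
    exact e2 _ _ hfst
  -- (T3) on `H₀`: `Z(q) ⊆ {q' = 1}` (the gate does not read)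
  have hII : ∀ w, q₀ w = 0 → q'₀ w = 1 := by
    intro w hw
    have hfst := caseP_fst I hI hT hW hL hG hT3 hP hw
    have hsum : ∑ i ∈ B.N.filter (fun i => ¬ (sys I B).u i (x₁ + (w : Fin n → ZMod 2)) = 0),
        ((sys I B).ρ i (x₁ + (w : Fin n → ZMod 2)) + (sys I B).ρ' i (x₁ + (w : Fin n → ZMod 2))).1 = 0 := by
      refine sum_eq_zero fun i hi => ?_
      have hi' : i = e := by
        have h := (mem_filter.1 hi).1
        rw [hN] at h
        exact mem_singleton.1 h
      subst hi'
      rw [(gate_reads I hI hG _).1, (gate_reads I hI hG _).2, add_zero, hc0]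
    rw [hsum, add_zero] at hfst
    show qDir I B (0, 1) (x₁ + (w : Fin n → ZMod 2)) = 1
    rw [qDir_zero_one, hfst]
    have e2 : ∀ b : ZMod 2, b + 1 + b = 1 := by decide
    exact e2 _
  -- an edge of `D e` avoiding `u`; its AND pair as a hyperbolic pair of the chamber
  obtain ⟨j, hj⟩ := avoid_nonempty I hI hS heD (hW.hDeven e he) u
  obtain ⟨hjD, hj2, hj3⟩ := mem_filter.1 hj
  rw [mem_singleton] at hj2 hj3
  have hjJ : j ∈ B.J₀ := hDJ hjD
  have hmemW : ∀ {c : Fin n}, c ≠ u → (Pi.single c (1 : ZMod 2) : Fin n → ZMod 2) ∈ W := by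
    intro c hc
    rw [mem_coordKer]
    intro w hw
    rw [mem_singleton] at hw
    subst hw
    exact Pi.single_eq_of_ne (Ne.symm hc) _
  set a : W := ⟨Pi.single (I.vars j 2) 1, hmemW hj2⟩ with hadef
  set b : W := ⟨Pi.single (I.vars j 3) 1, hmemW hj3⟩ with hbdef
  have hab : Bq a b = 1 := by
    rw [hBeq]
    show polar D (fun j => I.vars j 2) (fun j => I.vars j 3) (Pi.single (I.vars j 2) 1) (Pi.single (I.vars j 3) 1) = 1
    rw [polar_basis I hI hS, if_pos ((andAdj_iff_mem I hI hS D j).2 hjD)]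
  have hjT₂ : j ∈ B.T₂ := by
    by_contra hnot
    have h : Bq a b = 0 := by
      show polarDir I B (1, 0) (Pi.single (I.vars j 2) 1) (Pi.single (I.vars j 3) 1) = 0
      rw [polarDir_single_pair I hI hS hd₁ hd₂ (1, 0) hjJ, if_neg hnot]
      simp
    rw [hab] at h
    exact one_ne_zero h
  have hB'ab : Bq' a b = if j ∈ B.T₁ then 1 else 0 := by
    show polarDir I B (0, 1) (Pi.single (I.vars j 2) 1) (Pi.single (I.vars j 3) 1) = if j ∈ B.T₁ then 1 else 0
    rw [polarDir_single_pair I hI hS hd₁ hd₂ (0, 1) hjJ]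
    simp
  -- (M0) at `j`, defect form
  obtain ⟨z, hz⟩ := hM0 j hjJ
  have hpp' : I.vars e 2 ≠ I.vars e 3 := fun h => absurd (hI.2 e h) (by decide)
  have hp'priv : I.vars e 3 ∈ privs I B.N := vars_mem_privs I he (s := 3) (by decide)
  obtain ⟨hunG₁, hunG₂⟩ := hG.2.1 _ hp'priv (Ne.symm hpp')
  have hG₁'' : ∀ g ∈ B.G₁.erase g₀, I.vars g 2 ≠ I.vars e 2 ∧ I.vars g 2 ≠ I.vars e 3 ∧ I.vars g 3 ≠ I.vars e 2 ∧ I.vars g 3 ≠ I.vars e 3 :=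
    fun g hg => ⟨(hG₁p g hg).1, (hunG₁ g (mem_of_mem_erase hg)).1, (hG₁p g hg).2, (hunG₁ g (mem_of_mem_erase hg)).2⟩
  have hG₂'' : ∀ g ∈ B.G₂, I.vars g 2 ≠ I.vars e 2 ∧ I.vars g 2 ≠ I.vars e 3 ∧ I.vars g 3 ≠ I.vars e 2 ∧ I.vars g 3 ≠ I.vars e 3 :=
    fun g hg => ⟨(hG.2.2.1 g hg).1, (hunG₂ g hg).1, (hG.2.2.1 g hg).2, (hunG₂ g hg).2⟩
  obtain ⟨-, hval⟩ := gate_forest_minimality I hI hT hW he hjD hg₀ hgv hup hG₁'' hG₂'' hz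
  have hδ := defect_eq_one I hI hW he hjD hT3 hz
  set x : Fin n → ZMod 2 := fun v => bit (z v) with hxdef
  rw [hδ, if_pos hjT₂, hN, val_singleton, (gate_reads I hI hG x).1, (gate_reads I hI hG x).2, smul_zero, add_zero] at hval
  -- components: `q(x) = 1`, `q'(x) = [j ∈ T₁] + x_p · ℓ(x)`
  have hqx : qDir I B (1, 0) x = 1 := by
    have h := congrArg Prod.snd hval
    simp only [Prod.snd_add, Prod.smul_snd, smul_eq_mul, mul_zero, add_zero] at h
    rw [qDir_one_zero, h]
    have e2 : ∀ t : ZMod 2, t + 1 + t = 1 := by decide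
    exact e2 _
  have hq'x : qDir I B (0, 1) x = (if j ∈ B.T₁ then 1 else 0) + bit (z (I.vars e 2)) * coef I B.C₁ B.G₁ (I.vars e 2) x := by
    have h := congrArg Prod.fst hval
    simp only [Prod.fst_add, Prod.smul_fst, smul_eq_mul] at h
    rw [qDir_zero_one]
    have e3 : ∀ f pc t τ : ZMod 2, f + pc = t + τ → f + t = τ + pc := by decide
    exact e3 _ _ _ _ h
  -- the (M0) datum of the model lemma, by chamber
  have hM0' : (∃ w, q₀ w = 1 ∧ q'₀ w = Bq' a b) ∨ (∃ w, ∃ π : ZMod 2, q₁ w = 1 ∧ q'₁ w = Bq' a b + π ∧ (Q₁ w = 0 → π = 1)) := by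
    have hxu : x u = κ₀ + 1 ∨ x u = κ₀ := by
      have e2 : ∀ s k : ZMod 2, s = k + 1 ∨ s = k := by decide
      exact e2 _ _
    rcases hxu with hxu | hxu
    · -- the witness lies in `H₁`
      right
      have hxW : x + x₀ ∈ W := by
        rw [mem_coordKer]
        intro w hw
        rw [mem_singleton] at hw
        subst hw
        rw [Pi.add_apply, hxu, hx₀u, CharTwo.add_self_eq_zero]
      have hxx : x₀ + (x + x₀) = x := by
        ext v
        rw [Pi.add_apply, Pi.add_apply, add_comm (x v), ← add_assoc, CharTwo.add_self_eq_zero, zero_add]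
      have hcx : coef I B.C₁ B.G₁ (I.vars e 2) x = 1 := by
        rw [hcoef, hxu]
        have e2 : ∀ k : ZMod 2, k + (k + 1) = 1 := by decide
        exact e2 κ₀
      refine ⟨⟨x + x₀, hxW⟩, bit (z (I.vars e 2)), ?_, ?_, ?_⟩
      · show qDir I B (1, 0) (x₀ + (x + x₀)) = 1
        rw [hxx]; exact hqx
      · show qDir I B (0, 1) (x₀ + (x + x₀)) = Bq' a b + bit (z (I.vars e 2))
        rw [hxx, hq'x, hB'ab, hcx, mul_one]
      · intro hQ
        have hQ' : (sys I B).u e x = 0 := by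
          have h := hQ
          simp only [hQ₁def] at h
          rw [hxx] at h
          exact h
        rw [hQ', zero_add] at hδ
        have e2 : ∀ s t : ZMod 2, s * t = 1 → s = 1 := by decide
        exact e2 _ _ hδ
    · -- the witness lies in `H₀`
      left
      have hxW : x + x₁ ∈ W := by
        rw [mem_coordKer]
        intro w hw
        rw [mem_singleton] at hw
        subst hw
        rw [Pi.add_apply, hxu, hx₁u, CharTwo.add_self_eq_zero]
      have hxx : x₁ + (x + x₁) = x := by
        ext v
        rw [Pi.add_apply, Pi.add_apply, add_comm (x v), ← add_assoc, CharTwo.add_self_eq_zero, zero_add]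
      have hcx : coef I B.C₁ B.G₁ (I.vars e 2) x = 0 := by
        rw [hcoef, hxu]; exact CharTwo.add_self_eq_zero κ₀
      refine ⟨⟨x + x₁, hxW⟩, ?_, ?_⟩
      · show qDir I B (1, 0) (x₁ + (x + x₁)) = 1
        rw [hxx]; exact hqx
      · show qDir I B (0, 1) (x₁ + (x + x₁)) = Bq' a b
        rw [hxx, hq'x, hB'ab, hcx, mul_zero, add_zero]
  exact eq_chambers_false hq₁ hrank hq'₁ h₀ h₀' hEQ' hZ hpt hI' hII hab hM0'

/-- **N6 (v2) `GateUnitCycleQuadX` HOLDS: the single gated cycle has at most five outputs.** -/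
theorem gateUnitCycleQuadX_holds : GateUnitCycleQuadX := by
  intro n m r I hI hT hS hB B e g₀ u κ₀ hD hN _
  classical
  rcases single_chamber_cases I hI hT hS hB hD hN with h3 | ⟨-, -, hZ, hreg⟩
  · omega
  by_cases hav : (avoid I (B.D e) {u}).card ≤ 2
  · exact card_le_five_of_avoid_le_two I hI hT hB hD hN hav
  exfalso
  have h6 := rank_six_on_chamber I hI hT hS hB hD hN (by omega)
  set W : Submodule (ZMod 2) (Fin n → ZMod 2) := coordKer ({u} : Finset (Fin n)) with hWdef
  set x₀ : Fin n → ZMod 2 := Pi.single u (κ₀ + 1) with hx₀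
  have hPq : ∀ v w : W, qform (B.D e) (fun j => I.vars j 2) (fun j => I.vars j 3) (x₀ + ((v + w : W) : Fin n → ZMod 2)) =
      qform (B.D e) (fun j => I.vars j 2) (fun j => I.vars j 3) (x₀ + (v : Fin n → ZMod 2)) +
      qform (B.D e) (fun j => I.vars j 2) (fun j => I.vars j 3) (x₀ + (w : Fin n → ZMod 2)) +
      qform (B.D e) (fun j => I.vars j 2) (fun j => I.vars j 3) (x₀ + ((0 : W) : Fin n → ZMod 2)) +
      ((polar (B.D e) (fun j => I.vars j 2) (fun j => I.vars j 3)).restrict W) v w := quad_restrict (qform_add' I (B.D e)) W x₀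
  rcases hreg with hEQ | ⟨ν₁, ν₂, hν₁, hν₂, κ, hE⟩ | ⟨a, b, -, -, m₁, m₂, hm₁, hm₂, hQ⟩
  · exact eq_false_of_rank_six I hI hT hS hD hN h6 hEQ
  · -- (EXC) is (EQ) at rank six
    have hc := exc_product_const (P := fun w : W => qform (B.D e) (fun j => I.vars j 2) (fun j => I.vars j 3) (x₀ + (w : Fin n → ZMod 2)))
      (q₁ := fun w : W => qDir I B (1, 0) (x₀ + (w : Fin n → ZMod 2))) hPq h6 hν₁ hν₂ (κ := κ) (c := gam B e + 1) hE hZ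
    refine eq_false_of_rank_six I hI hT hS hD hN h6 ⟨ν₁ 0 * ν₂ 0 + κ, fun w => ?_⟩
    rw [hE w, hc w, add_assoc]
  · -- (NOR) contradicts rank six
    set Bq := (polarDir I B (1, 0)).restrict W with hBq
    have haff : ∀ (y : W) (k : ZMod 2), IsAffineFn (fun w : W => Bq w y + k) := fun y k => isAffineFn_of_linear (Bq.flip y) k
    exact nor_not_rank_six hPq (haff b _) (haff a _) hm₁ hm₂ hQ h6

end Summit.PneNP.PneNP.Theorems.PstarGateUnitCycleQuad
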